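import Mathlib
import Literature.NumberTheory.Sieve.PretentiousDistance
import Literature.NumberTheory.LFunctions.PretentiousZeta
import HarnessLib

/-!
# Route LiouvilleSarnak — `AlignedTypeI` (stmt-ValiantsHypothesis-21040), line `characters_mod_2n`:
# the squaring inequality `𝔻(χ², n^{2it}; x)² ≤ 4 𝔻(λχ, n^{it}; x)²` (brick for `stub_twistedLiouvilleSmall` at all levels)

Hand g1 (`…CharactersMod2nTwistedLiouvilleLinear.lean`) proved the registered stub `stub_twistedLiouvilleSmall` on the levels
`k ≤ δ(ε) n` from Halász's theorem and the identity `𝔻(λχ, n^{it}; x)² = log log x + log |L(σ_x − it, χ̄)| + O(1)`; the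
full range `k ≤ n` (conductor up to `√x`) needs `𝔻(λχ, n^{it}; x)² → ∞` uniformly, i.e. a lower bound for `|L|` near `1`
beating `1/log x` by a large factor, which Montgomery–Vaughan Thm 11.4 gives only for `2^k ≤ x^{δ}`.

This file proves the elementary SQUARING INEQUALITY that converts the problem into an UPPER bound for `L(s, χ²)` near
`σ = 1`: for `|z| ≤ 1`, `1 − Re z² ≤ 4 (1 + Re z)` (`re_sq_ineq`), hence termwise over primes
`𝔻(g, n^{2it}; x)² ≤ 4 · 𝔻(f, n^{it}; x)²` whenever `f(p) = −χ(p)` and `g(p) = χ(p)²` at primes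
(`pretentiousDistSq_sq_le`).  With the distance formula for `ψ = χ²` (tree, `PretentiousZeta` /
`exists_pretentiousDistSq_one_twistedChar_approx`) this reads
`𝔻(λχ, n^{it}; x)² ≥ ¼ (log log x − log |L(σ_x + 2it, χ²)|) − O(1)`, so `stub_twistedLiouvilleSmall` at ALL levels follows
from `|L(σ + iu, ψ)| ≤ ε' log q_ψ + C(ε', U)` for primitive `ψ` of large 2-power conductor — i.e. from short character sums to
2-power moduli of length `q^{ε'}` (Postnikov 1956 / Gallagher 1972; fixed-degree Weyl differencing), the one input not in the
tree (see the item's evidence `evidence-21040-leafhand-g3.md` §3).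

HONEST FRAMING.  An inequality between two prime sums; it closes nothing.  `stub_twistedLiouvilleSmall` is idle for the crux
(`alignedTypeI_of_KMTVariance`), `AlignedTypeI` is NOT closed, `VP ≠ VNP` is NOT touched.
-/

set_option linter.dupNamespace false

noncomputable section

namespace Summit.ValiantsHypothesis.ValiantsHypothesis.Theorems.LiouvilleSarnak.AlignedTypeI.CharactersModTwoN

open Finset Complex
open scoped ComplexConjugate
open Literature.NumberTheory.Sieve (pretentiousDistSq twistedChar)
open Literature.NumberTheory.LFunctions (sigmaX)

/-- For `|z| ≤ 1`: `1 − Re(z²) ≤ 4 (1 + Re z)` (with `z = a + bi`, `a² + b² ≤ 1`, this is `2(a+1)² ≥ 0` after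
`b² ≤ 1 − a²`). [folklore] -/
theorem re_sq_ineq {z : ℂ} (hz : ‖z‖ ≤ 1) : 1 - (z ^ 2).re ≤ 4 * (1 + z.re) := by
  have hn : z.re ^ 2 + z.im ^ 2 ≤ 1 := by
    have h1 : Complex.normSq z ≤ 1 := by
      rw [Complex.normSq_eq_norm_sq]
      nlinarith [norm_nonneg z]
    rw [Complex.normSq_apply] at h1
    nlinarith
  have hre : (z ^ 2).re = z.re ^ 2 - z.im ^ 2 := by
    rw [pow_two, Complex.mul_re]; ring
  rw [hre]
  nlinarith [sq_nonneg (z.re + 1)]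

/-- `‖conj((p : ℂ)^{it})‖ = 1` for `p ≥ 1`. [folklore] -/
theorem norm_conj_natCast_cpow_mul_I {p : ℕ} (hp : 0 < p) (t : ℝ) :
    ‖conj ((p : ℂ) ^ ((t : ℂ) * I))‖ = 1 := by
  rw [Complex.norm_conj, Complex.norm_natCast_cpow_of_pos hp]
  simp

/-- **Squaring inequality for pretentious distances.**  If `f(p) = −χ(p)` and `g(p) = χ(p)²` at every prime `p`
(e.g. `f = λχ`, `g = χ²`), then for all real `t, x`:
`𝔻(g, n^{2it}; x)² ≤ 4 · 𝔻(f, n^{it}; x)²` — termwise `1 − Re(χ(p)² p^{−2it}) ≤ 4 (1 + Re(χ(p) p^{−it}))` by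
`re_sq_ineq` with `z = χ(p) \overline{p^{it}}`, `|z| ≤ 1`. [folklore] -/
theorem pretentiousDistSq_sq_le {q : ℕ} (χ : DirichletCharacter ℂ q) {f g : ℕ → ℂ}
    (hf : ∀ p : ℕ, p.Prime → f p = -χ (p : ZMod q)) (hg : ∀ p : ℕ, p.Prime → g p = χ (p : ZMod q) ^ 2)
    (t x : ℝ) :
    pretentiousDistSq g (fun n : ℕ => (n : ℂ) ^ (((2 * t : ℝ) : ℂ) * I)) x ≤
      4 * pretentiousDistSq f (fun n : ℕ => (n : ℂ) ^ ((t : ℂ) * I)) x := by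
  unfold Literature.NumberTheory.Sieve.pretentiousDistSq
  rw [Finset.mul_sum]
  refine Finset.sum_le_sum fun p hp => ?_
  have hpp : p.Prime := Nat.prime_of_mem_primesLE hp
  have hp0 : (0 : ℝ) < p := by exact_mod_cast hpp.pos
  rw [hf p hpp, hg p hpp]
  set w : ℂ := conj ((p : ℂ) ^ ((t : ℂ) * I)) with hw
  have hw2 : conj ((p : ℂ) ^ (((2 * t : ℝ) : ℂ) * I)) = w ^ 2 := by
    rw [hw, ← map_pow, ← Complex.cpow_nat_mul]
    push_cast
    ring_nf
  rw [hw2]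
  set z : ℂ := χ (p : ZMod q) * w with hz
  have hz1 : ‖z‖ ≤ 1 := by
    rw [hz, norm_mul, hw, norm_conj_natCast_cpow_mul_I hpp.pos]
    simpa using χ.norm_le_one (p : ZMod q)
  have e1 : χ (p : ZMod q) ^ 2 * w ^ 2 = z ^ 2 := by rw [hz]; ring
  have e2 : (-χ (p : ZMod q) * w).re = -z.re := by rw [hz, neg_mul, Complex.neg_re]
  rw [e1, e2, mul_div_assoc', div_le_div_iff_of_pos_right hp0]
  have := re_sq_ineq hz1
  linarith


/-- `𝔻(1, χ̄²(n) n^{2it}; x)² = 𝔻(χ², n^{2it}; x)²` — the twisted-character distance of the tree's distance formula, for the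
character `(χ²)⁻¹` at height `2t`, is the distance of `g = χ²` from `n^{2it}` (`conj((χ²)⁻¹(p)) = χ(p)²`). [folklore] -/
theorem pretentiousDistSq_one_twistedChar_inv_sq {q : ℕ} (χ : DirichletCharacter ℂ q) {g : ℕ → ℂ}
    (hg : ∀ p : ℕ, p.Prime → g p = χ (p : ZMod q) ^ 2) (t x : ℝ) :
    pretentiousDistSq 1 (twistedChar (χ ^ 2)⁻¹ (2 * t)) x =
      pretentiousDistSq g (fun n : ℕ => (n : ℂ) ^ (((2 * t : ℝ) : ℂ) * I)) x := by
  unfold Literature.NumberTheory.Sieve.pretentiousDistSq Literature.NumberTheory.Sieve.twistedChar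
  refine Finset.sum_congr rfl fun p hp => ?_
  have hpp : p.Prime := Nat.prime_of_mem_primesLE hp
  rw [hg p hpp]
  have hconj : conj ((χ ^ 2)⁻¹ (p : ZMod q)) = χ (p : ZMod q) ^ 2 := by
    rw [← MulChar.star_apply', starRingEnd_apply, star_star, sq, MulChar.mul_apply, ← sq]
  simp only [Pi.one_apply, one_mul, map_mul, hconj]

/-- **The squaring lower bound.**  There are absolute `x₀ ≥ 3`, `C` such that for all `x ≥ x₀`, all moduli `q`, all
Dirichlet characters `χ` mod `q`, all `f` with `f(p) = −χ(p)` at primes (e.g. `f = λχ`) and all real `t`: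
`𝔻(f, n^{it}; x)² ≥ ¼ (log log x − log ‖L(σ_x − 2it, χ̄²)‖) − C`, `σ_x = 1 + 1/log x`, `L` the Dirichlet series of
`(χ²)⁻¹`.  (`pretentiousDistSq_sq_le` + the tree's distance formula `exists_pretentiousDistSq_one_twistedChar_approx` for
the character `(χ²)⁻¹` at height `2t`.)  Consequently `𝔻(λχ, n^{it}; x)² → ∞` uniformly as soon as
`‖L(σ_x − 2it, χ̄²)‖ = o(log x)` uniformly — an UPPER bound for `L` near `1`. [folklore] -/
theorem exists_pretentiousDistSq_ge_quarter :
    ∃ x₀ C : ℝ, 3 ≤ x₀ ∧ ∀ x : ℝ, x₀ ≤ x → ∀ (q : ℕ) (χ : DirichletCharacter ℂ q) (f : ℕ → ℂ),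
      (∀ p : ℕ, p.Prime → f p = -χ (p : ZMod q)) → ∀ t : ℝ,
        (Real.log (Real.log x)
            - Real.log ‖LSeries (fun n : ℕ => (χ ^ 2)⁻¹ n) ((sigmaX x : ℂ) - (2 * t : ℝ) * I)‖) / 4 - C
          ≤ pretentiousDistSq f (fun n : ℕ => (n : ℂ) ^ ((t : ℂ) * I)) x := by
  obtain ⟨x₀, C, hx₀, H⟩ := Literature.NumberTheory.LFunctions.exists_pretentiousDistSq_one_twistedChar_approx
  refine ⟨x₀, C / 4, hx₀, fun x hx q χ f hf t => ?_⟩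
  have hD := H x hx q (χ ^ 2)⁻¹ (2 * t)
  rw [abs_le] at hD
  rw [pretentiousDistSq_one_twistedChar_inv_sq χ (g := fun n => χ (n : ZMod q) ^ 2) (fun p _ => rfl) t x] at hD
  have hsq := pretentiousDistSq_sq_le χ hf (g := fun n => χ (n : ZMod q) ^ 2) (fun p _ => rfl) t x
  obtain ⟨hD1, _⟩ := hD
  linarith

end Summit.ValiantsHypothesis.ValiantsHypothesis.Theorems.LiouvilleSarnak.AlignedTypeI.CharactersModTwoN
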